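import Summits.AtomisticToContinuum.HydrodynamicLimit.Theses.ImplosionDichotomy
import Summits.AtomisticToContinuum.HydrodynamicLimit.Theorems.DenseExcursion.Negative.AtTimeZero

/-!
# `PolynomialCompression` is a particle-free PDE statement: admissible data are PINNED to `(rhoLim, u₀, θ₀)`

Negative-side structure for the crux `ImplosionDichotomy.PolynomialCompression` (stmt-AtomisticToContinuum-12587),
from the standing disprover's `Cruxes/PolynomialCompression/Disproof.lean` §1–§4 (cycles 1–3), landed so that line
skeletons (`Lines/eos-defect-as-forcing.lean` stub 4, `Lines/conformal-clock.lean` stub 2,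
`Lines/log-lipschitz-budget.lean` stub 2) and sibling seats can IMPORT it instead of re-deriving it:
* `tendstoHydroFieldsAt_zero_iff_flowFree` — the `t = 0` tie through ANY flow family is the FLOW-FREE tie
  (`Φ_0 = id` a.e.; `localGibbsLaw_preimage_flow_zero`): three convergences in probability under `localGibbsMeasure`;
* `lln_rhoLim` — the local-equilibrium LAW OF LARGE NUMBERS WITH IDENTIFIED DENSITY: below a threshold
  `σ₁(a₀,θ₀,u₀) ≤ 1/2` the local Gibbs laws are probability measures and their `t = 0` empirical fields converge in
  probability, through every flow family, to those of the constant-in-time fields `(rhoLim (profileOf a₀) σ, u₀, θ₀)`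
  (the tree's PROVED `localGibbs_lln_holds` gives SOME continuous `ρ₀`; uniqueness of limits in probability against
  the PROVED `localGibbs_densityLLN` — `DenseExcursionAtTimeZero.densityLLN_rhoLim` — identifies `ρ₀ = rhoLim`);
* `data_eq_of_flowFree` / `admissible_iff_data` — DATA PINNING: fields with continuous time-`0` slices are admissible
  (tied through every flow family) IFF `ρ 0 = rhoLim (profileOf a₀) σ ∧ u 0 = u₀ ∧ θ 0 = θ₀` — the hard-sphere Euler
  data of the route's items are NOT free (density: uniqueness of limits; momentum: coordinatewise; energy: divide by
  `rhoLim > 0`);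
* statics of the pinned density live in `Negative/Statics.lean` (`|rhoLim − β| ≤ 16e²v₁M²σ³`, `|R − 1| = O(σ³)`,
  `∫ rhoLim = 1`) and `DenseExcursionAtTimeZero.rhoLim_lt` (`rhoLim < (2e+1)M` uniformly in `σ`);
* `polynomialCompression_iff_pde` — THE CRUX WITHOUT PARTICLES: `PolynomialCompression ↔ PolynomialCompressionPDE`,
  a deterministic statement about ONE explicit data family `(rhoLim (profileOf a₀) σ, u₀, θ₀)` of the classical
  hard-sphere Euler system `p = ρθZ(ρσ³)`; `not_polynomialCompression_iff_pde` — a disproof is a σ-uniform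
  sub-polynomial `L∞` bound for that family (cf. `Negative/Ladder.lean`: it would prove `DiluteSelfConsistency`).
refuter-cdisprove-stmt-AtomisticToContinuum-12587-g3-0.
-/

noncomputable section

namespace Summit.AtomisticToContinuum.HydrodynamicLimit.Theorems

open MeasureTheory Filter Set Topology
open scoped ENNReal
open Literature.MathematicalPhysics.KineticTheory Literature.Analysis.FluidPDE
open Literature.Analysis.FunctionSpaces
open Summit.AtomisticToContinuum.HydrodynamicLimit.Theses.ImplosionDichotomy (PolynomialCompression)

/-- **`PolynomialCompression`, de-probabilised.** No flows, no measures, no LLN: along some sequence `σ → 0`, the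
classical hard-sphere-Euler solution (pressure `p = ρθ Z(ρσ³)`) with the PINNED data `(rhoLim (profileOf a₀) σ, u₀, θ₀)`
reaches density `σ^(-κ)` on its interval of classical existence. Equivalent to the crux
(`polynomialCompression_iff_pde`). -/
def PolynomialCompressionPDE : Prop :=
  ∃ κ : ℝ, 0 < κ ∧ ∃ (a₀ θ₀ : T3 → ℝ) (u₀ : T3 → V3) (ha : Continuous a₀) (ha0 : ∀ x, 0 < a₀ x),
    Continuous θ₀ ∧ Continuous u₀ ∧ (∀ x, 0 < θ₀ x) ∧
    ∀ σ₀ : ℝ, 0 < σ₀ → ∃ σ : ℝ, 0 < σ ∧ σ < σ₀ ∧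
      ∃ (T : ℝ) (ρ θ : ℝ → T3 → ℝ) (u : ℝ → T3 → V3), IsHardSphereEulerSolution σ T ρ u θ ∧
        ρ 0 = rhoLim (profileOf a₀ ha ha0) σ ∧ u 0 = u₀ ∧ θ 0 = θ₀ ∧
        ∃ t ∈ Ico 0 T, ∃ x, σ ^ (-κ) ≤ ρ t x

namespace PolynomialCompressionPDE

/-- A family of hard-sphere flows, one per particle number, at reduced density `σ`. -/
abbrev Flows (σ : ℝ) :=
  (N : ℕ) → HardSphereFlow (Torus.geometry (Fin 3)) (hsDiameter σ N) (N + 1)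

/-- Flow families exist at every reduced density `0 < σ < 1/2` (Alexander's theorem on `𝕋³`,
`HardSphereFlow.nonempty_torus_holds`, with `hsDiameter σ N ≤ σ < 1/2`). [folklore] -/
theorem flows_nonempty {σ : ℝ} (hσ : 0 < σ) (hσ2 : σ < 1 / 2) : Nonempty (Flows σ) :=
  ⟨fun N => Classical.choice (HardSphereFlow.nonempty_torus_holds (d := Fin 3)
    (hsDiameter_pos hσ N) ((hsDiameter_le hσ.le N).trans_lt (hσ2.trans_eq (by norm_num))) (N + 1))⟩

/-- The FLOW-FREE `t = 0` tie of time-`0` data `(r, v, ϑ)` to the profiles `(a₀, u₀, θ₀)` at reduced density `σ`: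
the three convergences in probability of `TendstoHydroFieldsAt … 0`, but under the flow-free local Gibbs MEASURE
`localGibbsMeasure` and for the UNMOVED configuration. -/
def FlowFreeTie (σ : ℝ) (a₀ : T3 → ℝ) (u₀ : T3 → V3) (θ₀ : T3 → ℝ) (r : T3 → ℝ) (v : T3 → V3) (ϑ : T3 → ℝ) :
    Prop :=
  ∀ χ : T3 → ℝ, Continuous χ → ∀ δ > (0 : ℝ),
    Tendsto (fun N => localGibbsMeasure σ a₀ u₀ θ₀ N
      {z | δ < |empiricalDensityField z χ - ∫ x, χ x * r x|}) atTop (𝓝 0) ∧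
    Tendsto (fun N => localGibbsMeasure σ a₀ u₀ θ₀ N
      {z | δ < ‖empiricalMomentumField z χ - ∫ x, (χ x * r x) • v x‖}) atTop (𝓝 0) ∧
    Tendsto (fun N => localGibbsMeasure σ a₀ u₀ θ₀ N
      {z | δ < |empiricalEnergyField z χ - ∫ x, χ x * totalEnergyDensity (r x) (v x) (ϑ x)|}) atTop (𝓝 0)

/-- **The tie through any flow family is the flow-free tie of the time-`0` slices** (no hypothesis on `σ` or the
profiles). [folklore] -/
theorem tendstoHydroFieldsAt_zero_iff_flowFree {σ : ℝ} {a₀ θ₀ : T3 → ℝ} {u₀ : T3 → V3} (Φ : Flows σ)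
    {ρ θ : ℝ → T3 → ℝ} {u : ℝ → T3 → V3} :
    TendstoHydroFieldsAt (fun N => localGibbsLaw σ a₀ u₀ θ₀ N (Φ N)) Φ ρ u θ 0 ↔
      FlowFreeTie σ a₀ u₀ θ₀ (ρ 0) (u 0) (θ 0) := by
  unfold TendstoHydroFieldsAt FlowFreeTie
  have key : ∀ (N : ℕ) (p : Config (N + 1) (Fin 3) T3 → Prop),
      localGibbsLaw σ a₀ u₀ θ₀ N (Φ N) {z | p ((Φ N).flow 0 z)} = localGibbsMeasure σ a₀ u₀ θ₀ N {z | p z} :=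
    fun N p => localGibbsLaw_preimage_flow_zero σ a₀ u₀ θ₀ N (Φ N) {z | p z}
  refine forall_congr' fun χ => forall_congr' fun _ => forall_congr' fun δ => forall_congr' fun _ => ?_
  have h1 : (fun N => localGibbsLaw σ a₀ u₀ θ₀ N (Φ N)
      {z | δ < |empiricalDensityField ((Φ N).flow 0 z) χ - ∫ x, χ x * ρ 0 x|}) =
      fun N => localGibbsMeasure σ a₀ u₀ θ₀ N {z | δ < |empiricalDensityField z χ - ∫ x, χ x * ρ 0 x|} :=
    funext fun N => key N fun z => δ < |empiricalDensityField z χ - ∫ x, χ x * ρ 0 x|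
  have h2 : (fun N => localGibbsLaw σ a₀ u₀ θ₀ N (Φ N)
      {z | δ < ‖empiricalMomentumField ((Φ N).flow 0 z) χ - ∫ x, (χ x * ρ 0 x) • u 0 x‖}) =
      fun N => localGibbsMeasure σ a₀ u₀ θ₀ N
        {z | δ < ‖empiricalMomentumField z χ - ∫ x, (χ x * ρ 0 x) • u 0 x‖} :=
    funext fun N => key N fun z => δ < ‖empiricalMomentumField z χ - ∫ x, (χ x * ρ 0 x) • u 0 x‖
  have h3 : (fun N => localGibbsLaw σ a₀ u₀ θ₀ N (Φ N)
      {z | δ < |empiricalEnergyField ((Φ N).flow 0 z) χ -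
        ∫ x, χ x * totalEnergyDensity (ρ 0 x) (u 0 x) (θ 0 x)|}) =
      fun N => localGibbsMeasure σ a₀ u₀ θ₀ N
        {z | δ < |empiricalEnergyField z χ - ∫ x, χ x * totalEnergyDensity (ρ 0 x) (u 0 x) (θ 0 x)|} :=
    funext fun N => key N fun z => δ < |empiricalEnergyField z χ -
      ∫ x, χ x * totalEnergyDensity (ρ 0 x) (u 0 x) (θ 0 x)|
  rw [h1, h2, h3]

/-- **Limits in probability are unique** (eventually-probability laws, observables in a normed group): if the laws
of `F N` concentrate at `a` and at `b` then `a = b`. [folklore] -/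
theorem eq_of_tendsto_measure_lt {Ω : ℕ → Type*} [∀ N, MeasurableSpace (Ω N)]
    {P : (N : ℕ) → Measure (Ω N)} (hP : ∀ᶠ N in atTop, IsProbabilityMeasure (P N))
    {E : Type*} [NormedAddCommGroup E] {F : (N : ℕ) → Ω N → E} {a b : E}
    (ha : ∀ δ > (0 : ℝ), Tendsto (fun N => P N {z | δ < ‖F N z - a‖}) atTop (𝓝 0))
    (hb : ∀ δ > (0 : ℝ), Tendsto (fun N => P N {z | δ < ‖F N z - b‖}) atTop (𝓝 0)) : a = b := by
  by_contra hab
  have hd : 0 < ‖a - b‖ := norm_pos_iff.2 (sub_ne_zero.2 hab)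
  set δ := ‖a - b‖ / 3 with hδ
  have hδ0 : 0 < δ := by positivity
  have hcover : ∀ N, (univ : Set (Ω N)) ⊆ {z | δ < ‖F N z - a‖} ∪ {z | δ < ‖F N z - b‖} := by
    intro N z _
    by_contra hz
    simp only [Set.mem_union, Set.mem_setOf_eq, not_or, not_lt] at hz
    have : ‖a - b‖ ≤ ‖F N z - a‖ + ‖F N z - b‖ := by
      calc ‖a - b‖ = ‖(F N z - b) - (F N z - a)‖ := by congr 1; abel
        _ ≤ ‖F N z - b‖ + ‖F N z - a‖ := norm_sub_le _ _
        _ = ‖F N z - a‖ + ‖F N z - b‖ := add_comm _ _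
    linarith [hz.1, hz.2]
  have hle : ∀ᶠ N in atTop, (1 : ℝ≥0∞) ≤ P N {z | δ < ‖F N z - a‖} + P N {z | δ < ‖F N z - b‖} := by
    filter_upwards [hP] with N hPN
    calc (1 : ℝ≥0∞) = P N univ := measure_univ.symm
      _ ≤ P N ({z | δ < ‖F N z - a‖} ∪ {z | δ < ‖F N z - b‖}) := measure_mono (hcover N)
      _ ≤ _ := measure_union_le _ _
  have hlim : Tendsto (fun N => P N {z | δ < ‖F N z - a‖} + P N {z | δ < ‖F N z - b‖}) atTop (𝓝 0) := by
    simpa using (ha δ hδ0).add (hb δ hδ0)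
  exact absurd (ge_of_tendsto hlim hle) (by simp)

/-- Coordinates of a Bochner integral of a `V3`-valued function on `𝕋³`. [folklore] -/
theorem integral_apply_coord {F : T3 → V3} (hF : Integrable F volume) (i : Fin 3) :
    (∫ x, F x) i = ∫ x, F x i :=
  ((EuclideanSpace.proj i : V3 →L[ℝ] ℝ).integral_comp_comm hF).symm

open DenseExcursionAtTimeZero (eq_of_tendsto_measure_lt_abs eq_of_forall_integral_mul_eq densityLLN_rhoLim)

/-- **The local-equilibrium law of large numbers with IDENTIFIED density.** For continuous profiles `a₀, θ₀ > 0`,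
`u₀` there is `σ₁ ∈ (0, 1/2]` such that for `0 < σ < σ₁`: the quantitative statics package `SmallDensity` holds with
its positivity margin, and the local Gibbs laws are probability measures whose empirical fields at `t = 0` converge
in probability, through EVERY flow family, to those of the constant-in-time fields `(rhoLim (profileOf a₀) σ, u₀, θ₀)`.
(`localGibbs_lln_holds` gives some continuous `ρ₀`; uniqueness of limits in probability against `densityLLN_rhoLim`
identifies `ρ₀ = rhoLim`.) [folklore] -/
theorem lln_rhoLim {a₀ θ₀ : T3 → ℝ} {u₀ : T3 → V3} (ha : Continuous a₀) (hθ : Continuous θ₀)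
    (hu : Continuous u₀) (ha0 : ∀ x, 0 < a₀ x) (hθ0 : ∀ x, 0 < θ₀ x) :
    ∃ σ₁ : ℝ, 0 < σ₁ ∧ σ₁ ≤ 1 / 2 ∧ ∀ σ : ℝ, 0 < σ → σ < σ₁ →
      SmallDensity (profileOf a₀ ha ha0) σ ∧
      (∀ x, 4 * Real.exp 1 * (profileOf a₀ ha ha0).M * geomRatio (profileOf a₀ ha ha0) σ /
          (1 - geomRatio (profileOf a₀ ha ha0) σ) < (profileOf a₀ ha ha0).β x) ∧
      ∀ Φ : Flows σ, (∀ N, IsProbabilityMeasure (localGibbsLaw σ a₀ u₀ θ₀ N (Φ N))) ∧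
        TendstoHydroFieldsAt (fun N => localGibbsLaw σ a₀ u₀ θ₀ N (Φ N)) Φ
          (fun _ => rhoLim (profileOf a₀ ha ha0) σ) (fun _ => u₀) (fun _ => θ₀) 0 := by
  set P := profileOf a₀ ha ha0 with hP
  obtain ⟨σa, hσa, Ha⟩ := localGibbs_lln_holds a₀ θ₀ u₀ ha hθ hu ha0 hθ0
  obtain ⟨σb, hσb, Hb⟩ := densityLLN_rhoLim ha ha0
  -- positivity margin `4eMθ/(1-θ) < min β` from the statics threshold at `m := min β`
  obtain ⟨x₀, -, hx₀⟩ := isCompact_univ.exists_isMinOn univ_nonempty P.continuous.continuousOn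
  have hβmin : ∀ y, P.β x₀ ≤ P.β y := fun y => (isMinOn_iff.mp hx₀) y (mem_univ y)
  obtain ⟨σc, hσc, Hc⟩ := exists_smallDensity P (P.pos x₀)
  refine ⟨min (min σa σb) (min σc (1 / 2)), lt_min (lt_min hσa hσb) (lt_min hσc (by norm_num)),
    (min_le_right _ _).trans (min_le_right _ _), fun σ hσ hσlt => ?_⟩
  have hσa' : σ < σa := lt_of_lt_of_le hσlt ((min_le_left _ _).trans (min_le_left _ _))
  have hσb' : σ < σb := lt_of_lt_of_le hσlt ((min_le_left _ _).trans (min_le_right _ _))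
  have hσc' : σ < σc := lt_of_lt_of_le hσlt ((min_le_right _ _).trans (min_le_left _ _))
  have hσ2 : σ ≤ 1 / 2 := (lt_of_lt_of_le hσlt ((min_le_right _ _).trans (min_le_right _ _))).le
  obtain ⟨h, hdens⟩ := Hb σ hσ hσb'
  obtain ⟨-, hposc⟩ := Hc σ hσ hσc'
  have hpos : ∀ x, 4 * Real.exp 1 * P.M * geomRatio P σ / (1 - geomRatio P σ) < P.β x :=
    fun x => hposc.trans_le (hβmin x)
  obtain ⟨ρ₀, hρc, -, Hlln⟩ := Ha σ hσ hσa'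
  refine ⟨h, hpos, fun Φ => ⟨(Hlln Φ).1, ?_⟩⟩
  have hT := (Hlln Φ).2
  have hid : ρ₀ = rhoLim P σ := by
    refine eq_of_forall_integral_mul_eq hρc h.continuous_rhoLim fun χ hχ => ?_
    have hflowfree := (tendstoHydroFieldsAt_zero_iff_flowFree Φ).1 hT
    refine eq_of_tendsto_measure_lt_abs (P := fun N => localGibbsMeasure σ a₀ u₀ θ₀ N)
      (F := fun N z => empiricalDensityField z χ)
      (Eventually.of_forall fun N => isProbabilityMeasure_localGibbsMeasure ha hθ hu ha0 hθ0 hσ2 N)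
      (fun δ hδ => (hflowfree χ hχ δ hδ).1) (fun δ hδ => ?_)
    refine (tendsto_localGibbsMeasure_densityEvent (u₀ := u₀) ha hθ hu (fun x => (ha0 x).le)
      hθ0 σ hdens hχ hδ).congr fun N => ?_
    show localGibbsMeasure σ a₀ u₀ θ₀ N
        {z | δ < |((N + 1 : ℕ) : ℝ)⁻¹ * ∑ i, χ (z i).1 - ∫ y, χ y * rhoLim P σ y|} =
      localGibbsMeasure σ a₀ u₀ θ₀ N {z | δ < |empiricalDensityField z χ - ∫ y, χ y * rhoLim P σ y|}
    simp only [empiricalDensityField_eq_sum]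
  subst hid
  exact hT

/-- **DATA PINNING (flow-free form).** If continuous time-`0` data `(r, v, ϑ)` satisfy the flow-free tie at
`σ ≤ 1/2`, and the tie also holds for `(ρ₀, u₀, θ₀)` with `ρ₀` continuous and positive (the LLN), then `r = ρ₀`,
`v = u₀`, `ϑ = θ₀` (uniqueness of limits in probability, field by field; momentum coordinatewise; `ρ₀ > 0` to divide).
[folklore] -/
theorem data_eq_of_flowFree {σ : ℝ} {a₀ θ₀ : T3 → ℝ} {u₀ : T3 → V3} (ha : Continuous a₀) (hθ : Continuous θ₀)
    (hu : Continuous u₀) (ha0 : ∀ x, 0 < a₀ x) (hθ0 : ∀ x, 0 < θ₀ x) (hσ2 : σ ≤ 1 / 2) {ρ₀ : T3 → ℝ}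
    (hρ₀c : Continuous ρ₀) (hρ₀pos : ∀ x, 0 < ρ₀ x) (hlln : FlowFreeTie σ a₀ u₀ θ₀ ρ₀ u₀ θ₀)
    {r ϑ : T3 → ℝ} {v : T3 → V3} (hrc : Continuous r) (hvc : Continuous v) (hϑc : Continuous ϑ)
    (ht : FlowFreeTie σ a₀ u₀ θ₀ r v ϑ) : r = ρ₀ ∧ v = u₀ ∧ ϑ = θ₀ := by
  have hP : ∀ᶠ N in atTop, IsProbabilityMeasure (localGibbsMeasure σ a₀ u₀ θ₀ N) :=
    Eventually.of_forall fun N => isProbabilityMeasure_localGibbsMeasure ha hθ hu ha0 hθ0 hσ2 N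
  -- density
  have hρ : r = ρ₀ := by
    refine eq_of_forall_integral_mul_eq hrc hρ₀c fun χ hχ => ?_
    exact eq_of_tendsto_measure_lt_abs (F := fun N z => empiricalDensityField z χ) hP
      (fun δ hδ => (ht χ hχ δ hδ).1) (fun δ hδ => (hlln χ hχ δ hδ).1)
  -- momentum, coordinatewise
  have hu' : v = u₀ := by
    have hvec : ∀ χ : T3 → ℝ, Continuous χ → ∫ x, (χ x * ρ₀ x) • v x = ∫ x, (χ x * ρ₀ x) • u₀ x := by
      intro χ hχ
      have e := eq_of_tendsto_measure_lt (E := V3) (F := fun N z => empiricalMomentumField z χ) hP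
        (fun δ hδ => (ht χ hχ δ hδ).2.1) (fun δ hδ => (hlln χ hχ δ hδ).2.1)
      rw [hρ] at e
      exact e
    have hcoord : ∀ i : Fin 3, (fun x => ρ₀ x * v x i) = fun x => ρ₀ x * u₀ x i := by
      intro i
      refine eq_of_forall_integral_mul_eq (hρ₀c.mul ((EuclideanSpace.proj i : V3 →L[ℝ] ℝ).continuous.comp hvc))
        (hρ₀c.mul ((EuclideanSpace.proj i : V3 →L[ℝ] ℝ).continuous.comp hu)) fun χ hχ => ?_
      have e := congrArg (fun w : V3 => w i) (hvec χ hχ)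
      simp only at e
      rw [integral_apply_coord (F := fun x => (χ x * ρ₀ x) • v x)
          (integrable_of_continuous_T3 ((hχ.mul hρ₀c).smul hvc)),
        integral_apply_coord (F := fun x => (χ x * ρ₀ x) • u₀ x)
          (integrable_of_continuous_T3 ((hχ.mul hρ₀c).smul hu))] at e
      simp only [PiLp.smul_apply, smul_eq_mul] at e
      simpa only [mul_assoc] using e
    funext x
    ext i
    exact mul_left_cancel₀ (hρ₀pos x).ne' (congrFun (hcoord i) x)
  -- energy
  have hθ' : ϑ = θ₀ := by
    have hE : (fun x => totalEnergyDensity (ρ₀ x) (u₀ x) (ϑ x)) = fun x => totalEnergyDensity (ρ₀ x) (u₀ x) (θ₀ x) := by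
      refine eq_of_forall_integral_mul_eq ?_ ?_ fun χ hχ => ?_
      · unfold totalEnergyDensity; fun_prop
      · unfold totalEnergyDensity; fun_prop
      · have e := eq_of_tendsto_measure_lt_abs (F := fun N z => empiricalEnergyField z χ) hP
          (fun δ hδ => (ht χ hχ δ hδ).2.2) (fun δ hδ => (hlln χ hχ δ hδ).2.2)
        rw [hρ, hu'] at e
        exact e
    funext x
    have hx := congrFun hE x
    unfold totalEnergyDensity at hx
    have := mul_left_cancel₀ (hρ₀pos x).ne' hx
    linarith
  exact ⟨hρ, hu', hθ'⟩

/-- **ADMISSIBILITY = PINNED DATA.** For continuous profiles `a₀, θ₀ > 0`, `u₀` there is `σ₁ ∈ (0, 1/2]` such that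
for `0 < σ < σ₁` (where `SmallDensity (profileOf a₀) σ` holds) and ANY fields with continuous time-`0` slices:
`(ρ, u, θ)` is admissible — tied at `t = 0` to the local Gibbs laws through EVERY flow family — iff
`ρ 0 = rhoLim (profileOf a₀) σ ∧ u 0 = u₀ ∧ θ 0 = θ₀`. [folklore] -/
theorem admissible_iff_data {a₀ θ₀ : T3 → ℝ} {u₀ : T3 → V3} (ha : Continuous a₀) (hθ : Continuous θ₀)
    (hu : Continuous u₀) (ha0 : ∀ x, 0 < a₀ x) (hθ0 : ∀ x, 0 < θ₀ x) :
    ∃ σ₁ : ℝ, 0 < σ₁ ∧ σ₁ ≤ 1 / 2 ∧ ∀ σ : ℝ, 0 < σ → σ < σ₁ →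
      SmallDensity (profileOf a₀ ha ha0) σ ∧
      ∀ (ρ θ : ℝ → T3 → ℝ) (u : ℝ → T3 → V3), Continuous (ρ 0) → Continuous (u 0) → Continuous (θ 0) →
        ((∀ Φ : Flows σ, TendstoHydroFieldsAt (fun N => localGibbsLaw σ a₀ u₀ θ₀ N (Φ N)) Φ ρ u θ 0) ↔
          ρ 0 = rhoLim (profileOf a₀ ha ha0) σ ∧ u 0 = u₀ ∧ θ 0 = θ₀) := by
  obtain ⟨σ₁, hσ₁, hσ₁2, H⟩ := lln_rhoLim ha hθ hu ha0 hθ0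
  refine ⟨σ₁, hσ₁, hσ₁2, fun σ hσ hσlt => ?_⟩
  obtain ⟨h, hpos, Hσ⟩ := H σ hσ hσlt
  have hσ2 : σ < 1 / 2 := hσlt.trans_le hσ₁2
  refine ⟨h, fun ρ θ u hρc huc hθc => ⟨fun hA => ?_, fun hD Φ => ?_⟩⟩
  · obtain ⟨Φ⟩ := flows_nonempty hσ hσ2
    -- (no expected type here: the slices `(fun _ => c) 0` beta-reduce on instantiation; an ascription would send
    -- the unifier unfolding `rhoLim`)
    have hlln := (tendstoHydroFieldsAt_zero_iff_flowFree Φ).1 (Hσ Φ).2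
    have hAff := (tendstoHydroFieldsAt_zero_iff_flowFree Φ).1 (hA Φ)
    exact data_eq_of_flowFree ha hθ hu ha0 hθ0 hσ2.le h.continuous_rhoLim (fun x => h.rhoLim_pos (hpos x)) hlln
      hρc huc hθc hAff
  · obtain ⟨hρ, hu', hθ'⟩ := hD
    refine (tendstoHydroFieldsAt_zero_iff_flowFree Φ).2 ?_
    rw [hρ, hu', hθ']
    have h2 := (tendstoHydroFieldsAt_zero_iff_flowFree Φ).1 (Hσ Φ).2
    exact h2

/-- Time-`0` slices of a classical solution on `[0, T)` with `0 < T` are continuous. [folklore] -/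
theorem continuous_slices_zero {σ T : ℝ} {ρ θ : ℝ → T3 → ℝ} {u : ℝ → T3 → V3}
    (hE : IsHardSphereEulerSolution σ T ρ u θ) (hT : 0 < T) :
    Continuous (ρ 0) ∧ Continuous (u 0) ∧ Continuous (θ 0) :=
  have h0 : (0 : ℝ) ∈ Ico 0 T := ⟨le_rfl, hT⟩
  ⟨(hE.smooth_density.isSmooth_slice h0).continuous, (hE.smooth_velocity.isSmooth_slice h0).continuous,
    (hE.smooth_temperature.isSmooth_slice h0).continuous⟩

end PolynomialCompressionPDE

open PolynomialCompressionPDE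

/-- **THE CRUX IS A PURE PDE STATEMENT**: `PolynomialCompression ↔ PolynomialCompressionPDE` (both directions shrink
`σ₀` below the statics threshold `σ₁(a₀, θ₀, u₀)` of `admissible_iff_data`; `T > 0` because `∃ t ∈ Ico 0 T`, so the
time-`0` slices are continuous). Consequently a PROOF of the crux is the ideal-gas implosion plus quantitative
EOS/data continuity for ONE explicit data family, and a DISPROOF is a σ-uniform sub-polynomial `L∞` density bound
for that family (`not_polynomialCompression_iff_pde`). [folklore] -/
theorem polynomialCompression_iff_pde : PolynomialCompression ↔ PolynomialCompressionPDE := by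
  constructor
  · rintro ⟨κ, hκ, a₀, θ₀, u₀, ha, hθ, hu, ha0, hθ0, H⟩
    obtain ⟨σ₁, hσ₁, -, G⟩ := admissible_iff_data ha hθ hu ha0 hθ0
    refine ⟨κ, hκ, a₀, θ₀, u₀, ha, ha0, hθ, hu, hθ0, fun σ₀ hσ₀ => ?_⟩
    obtain ⟨σ, hσ, hσlt, T, ρ, θ, u, hE, hA, t, ht, x, hx⟩ := H (min σ₀ σ₁) (lt_min hσ₀ hσ₁)
    obtain ⟨hρc, huc, hθc⟩ := continuous_slices_zero hE (ht.1.trans_lt ht.2)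
    obtain ⟨-, G'⟩ := G σ hσ (lt_of_lt_of_le hσlt (min_le_right _ _))
    obtain ⟨h1, h2, h3⟩ := (G' ρ θ u hρc huc hθc).1 hA
    exact ⟨σ, hσ, lt_of_lt_of_le hσlt (min_le_left _ _), T, ρ, θ, u, hE, h1, h2, h3, t, ht, x, hx⟩
  · rintro ⟨κ, hκ, a₀, θ₀, u₀, ha, ha0, hθ, hu, hθ0, H⟩
    obtain ⟨σ₁, hσ₁, -, G⟩ := admissible_iff_data ha hθ hu ha0 hθ0
    refine ⟨κ, hκ, a₀, θ₀, u₀, ha, hθ, hu, ha0, hθ0, fun σ₀ hσ₀ => ?_⟩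
    obtain ⟨σ, hσ, hσlt, T, ρ, θ, u, hE, h1, h2, h3, t, ht, x, hx⟩ := H (min σ₀ σ₁) (lt_min hσ₀ hσ₁)
    obtain ⟨hρc, huc, hθc⟩ := continuous_slices_zero hE (ht.1.trans_lt ht.2)
    obtain ⟨-, G'⟩ := G σ hσ (lt_of_lt_of_le hσlt (min_le_right _ _))
    exact ⟨σ, hσ, lt_of_lt_of_le hσlt (min_le_left _ _), T, ρ, θ, u, hE,
      (G' ρ θ u hρc huc hθc).2 ⟨h1, h2, h3⟩, t, ht, x, hx⟩

/-- **The disproof obligation in PDE form** (no particles): for every `κ > 0` and profiles, a threshold below which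
the classical hard-sphere-Euler solution with the pinned data `(rhoLim (profileOf a₀) σ, u₀, θ₀)` stays `< σ^(-κ)` on
its interval of existence. [folklore] -/
theorem not_polynomialCompression_iff_pde :
    ¬ PolynomialCompression ↔
      ∀ κ : ℝ, 0 < κ → ∀ (a₀ θ₀ : T3 → ℝ) (u₀ : T3 → V3) (ha : Continuous a₀) (ha0 : ∀ x, 0 < a₀ x),
        Continuous θ₀ → Continuous u₀ → (∀ x, 0 < θ₀ x) →
        ∃ σ₀ : ℝ, 0 < σ₀ ∧ ∀ σ : ℝ, 0 < σ → σ < σ₀ →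
          ∀ (T : ℝ) (ρ θ : ℝ → T3 → ℝ) (u : ℝ → T3 → V3), IsHardSphereEulerSolution σ T ρ u θ →
            ρ 0 = rhoLim (profileOf a₀ ha ha0) σ → u 0 = u₀ → θ 0 = θ₀ → ∀ t ∈ Ico 0 T, ∀ x, ρ t x < σ ^ (-κ) := by
  rw [polynomialCompression_iff_pde]
  unfold PolynomialCompressionPDE
  push Not
  rfl

end Summit.AtomisticToContinuum.HydrodynamicLimit.Theorems

end
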